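import Literature.NumberTheory.Automorphic.UnitaryDualPairDoubledDiagonalCommute
import Literature.NumberTheory.Automorphic.DoubledUnitaryRankOneSiegelGeneration
import HarnessLib

/-!
# The `V`-diagonal doubling lift commutes ON THE NOSE with Weil's `r_F` on the rational points of the doubled `W`-member;
# the doubled theta integral is invariant under them

Topic `NumberTheory/Automorphic`; namespace `Literature.NumberTheory.Automorphic.UnitaryGroup` (sequel of ★ `UnitaryDualPairDoubledDiagonalCommute`,
★ `DoubledUnitaryRankOneSiegelGeneration`).  KERNEL only: proved theorems, no definition, no named fact, no `sorry`.  Setting as there: `E/F`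
quadratic with conjugation `c`, `c δ = −δ ≠ 0`; hermitian `V` (`J_V = T_V ⊗ 1`, rank `N`), hermitian LINE `W` (`J_W = T_W ⊗ 1`); the dual pair
`(U(J_V), U(J_W))` in `Sp(𝕎_𝔸)` (enumeration `e`) and the DOUBLED pair `(U(J_V), U(J_W ⊕ᶠ −J_W))` in `Sp(𝕎□_𝔸)` (Gram
`𝕋 = doubledGramFin F (adelicGram F e T_V T_W)`, doubled enumeration `eD`); `IW(F)` = rational symplectic `γ` with base change `ι_{eD}(1 ⊗ w)`,
`w ∈ U := U(T_W ⊕ᶠ −T_W)(F)`.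
* §2 `doublingLift_toSp_adelicInl_mul_ratThetaLiftCont` — **`S̃(ι(h ⊗ 1)) · r_F(γ) = r_F(γ) · S̃(ι(h ⊗ 1))` in `Mp_ψ(𝕎□_𝔸)ᶜᵒⁿᵗ`** for
  `h ∈ U(J_V)(𝔸)`, `γ ∈ IW(F)`.  Both sides lie over the same element of `Sp□(𝔸)` (★ `proj_doublingLift_toSp_adelicInl_mul_ratSp`), so
  `w ↦ S̃ r_F(γ_w) S̃⁻¹` is the twist of `w ↦ r_F(γ_w)` by a character `χ : U →* ℂˣ` (★ `adelicMpCont.exists_eq_twist`); `χ = 1` on `P_Δ(F)`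
  by the EXACT commutation there (`…_of_rowSum`: ★ `doublingLift_mul_ratThetaLiftCont_of_mem_siegel`, ★ `conj_doublingDelta_mem_siegelParabolicPi_of_isDiag`,
  ★ `isDiag_toSp_doubled_rationalInr`), hence everywhere (★ `monoidHom_apply_eq_one_of_forall_rowSum`).  No splitting of `U(𝔸)`, no cocycle.
* §3 `thetaDistLM_omega_doublingLift_omega_ratThetaLiftCont`, `integral_thetaDistLM_omega_doublingLift_omega_ratThetaLiftCont` — hence
  `Θ(ω□(S̃(ι(g ⊗ 1)))(ω□(r_F γ)Ψ)) = Θ(ω□(S̃(ι(g ⊗ 1)))Ψ)` and **`I□(ω□(r_F γ)Ψ) = I□(Ψ)`**, `I□(Ψ) = ∫_{[U(J_V)]} Θ(ω□(S̃(ι(ξ̃⁻¹ ⊗ 1)))Ψ) dν(ξ)`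
  (Θ-rigidity ★ `thetaDist_omega_ratThetaLiftCont`, [Weil1964, n° 41 Thm 6]).

Written for the Hodge-CM cell `pub/hodgecm-mathlib`, floor 0, crux H413 (stmt-HodgeConjecture-24833), E-2 child line `F0_E2SiegelWeilWeilRange`,
row (INV)-theta of F0P4-p07's sheet `SW2c-BOUND-ASSEMBLY` (the child's `vDiagLift`, `ratDoubledW`, `TWD`, `eD`, `doubledThetaIntegral` are these
objects by `rfl`); seat F0P4-p02 (g3), 2026-08-31.  HC_CM is proved only modulo the printed citations until rung 0 closes; nothing here bears on
a summit statement.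

## References
* [GelbartPiatetskishapiroRallis1987] S. Gelbart, I. Piatetski-Shapiro, S. Rallis, LNM 1254 (1987), Part A §2 pp. 7–9.
* [MoeglinVignerasWaldspurger1987] C. Mœglin, M.-F. Vignéras, J.-L. Waldspurger, LNM 1291 (1987), Chap. 2 II.1.
* [Kudla1994] S. Kudla, *Splitting metaplectic covers of dual reductive pairs*, Israel J. Math. 87 (1994) 361–401, §3.
* [Li1992] J.-S. Li, J. reine angew. Math. 428 (1992) 177–217, §3 p. 181, (24) p. 184.
* [Weil1964] A. Weil, *Sur certains groupes d'opérateurs unitaires*, Acta Math. 111 (1964), Chap. I n° 13, Chap. III n° 40–41, Thm 6 p. 193.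
* [Weil1965] A. Weil, *Sur la formule de Siegel dans la théorie des groupes classiques*, Acta Math. 113 (1965), n° 52 Thm 5.
-/

set_option autoImplicit false

noncomputable section

open scoped Kronecker Matrix
open NumberField
open Literature.RepresentationTheory.HeisenbergGroup
open Literature.NumberTheory.Weil1964

namespace Literature.NumberTheory.Automorphic

namespace UnitaryGroup

/-! ## §2 The `V`-diagonal doubling lift commutes on the nose with `r_F` on the rational points of the doubled `W`-member -/

section DoubledPair

variable (F E : Type) [Field F] [NumberField F] [Field E] [NumberField E] [Algebra F E] [Algebra.IsQuadraticExtension F E]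
  (c : E ≃ₐ[F] E) {δ : E} (hcδ : c δ = -δ) (hδ : δ ≠ 0) {d : F} (hd : δ * δ = algebraMap F E d)
  (N : ℕ) {n : ℕ} (e : Fin N × Fin 1 ≃ Fin n)
  {TV : Matrix (Fin N) (Fin N) F} {TW : Matrix (Fin 1) (Fin 1) F} {TW2 : Matrix (Fin (1 + 1)) (Fin (1 + 1)) F}
  (hV : TV.IsSymm) (hW : TW.IsSymm) (hW2 : TW2.IsSymm) (hVd : IsUnit TV.det) (hWd : IsUnit TW.det)
  (hTW2 : TW2 = finSum 1 1 TW (-TW))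

local notation "𝕋□" => doubledGramFin F (GelbartRogawski1991.UnitaryDualPair.adelicGram F e TV TW)
local notation "h𝕋□" => isUnit_det_doubledGramFin F (GelbartRogawski1991.UnitaryDualPair.adelicGram F e TV TW)
  (GelbartRogawski1991.UnitaryDualPair.isUnit_det_adelicGram F e hVd hWd)
local notation "eD□" => (Equiv.trans (Equiv.trans (Equiv.prodCongr (Equiv.refl (Fin N)) (Equiv.symm finSumFinEquiv))
  (Equiv.prodSumDistrib (Fin N) (Fin 1) (Fin 1))) (Equiv.trans (Equiv.sumCongr e e) finSumFinEquiv) : Fin N × Fin (1 + 1) ≃ Fin (n + n))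
local notation "LE□" => (((Fin (n + n) → AdeleRing (𝓞 F) F) × (Fin (n + n) → AdeleRing (𝓞 F) F)) ≃ₗ[AdeleRing (𝓞 F) F]
  ((Fin (n + n) → AdeleRing (𝓞 F) F) × (Fin (n + n) → AdeleRing (𝓞 F) F)))
local notation "Sp□" => symplecticGroup (polar (Weil1964.adelicForm F (Fin (n + n)) (doubledGramFin F (GelbartRogawski1991.UnitaryDualPair.adelicGram F e TV TW))))
local notation "ιW□" => MonoidHom.comp (GelbartRogawski1991.UnitaryDualPair.toSp F E c N (1 + 1)
  (Equiv.trans (Equiv.trans (Equiv.prodCongr (Equiv.refl (Fin N)) (Equiv.symm finSumFinEquiv))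
    (Equiv.prodSumDistrib (Fin N) (Fin 1) (Fin 1))) (Equiv.trans (Equiv.sumCongr e e) finSumFinEquiv) : Fin N × Fin (1 + 1) ≃ Fin (n + n))
  (Matrix.map TV (algebraMap F E)) (Matrix.map TW2 (algebraMap F E)) hcδ hδ hd hV hW2 rfl rfl)
  (MonoidHom.comp (adelicInr F E c N (1 + 1) (Matrix.map TV (algebraMap F E)) (Matrix.map TW2 (algebraMap F E)))
    (toAdelic F E c (1 + 1) (Matrix.map TW2 (algebraMap F E))))
local notation "x□" => MonoidHom.comp (doublingLift F (GelbartRogawski1991.UnitaryDualPair.adelicGram F e TV TW)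
  (GelbartRogawski1991.UnitaryDualPair.isUnit_det_adelicGram F e hVd hWd))
  (MonoidHom.comp (GelbartRogawski1991.UnitaryDualPair.toSp F E c N 1 e (Matrix.map TV (algebraMap F E)) (Matrix.map TW (algebraMap F E)) hcδ hδ hd hV hW rfl rfl)
    (adelicInl F E c N 1 (Matrix.map TV (algebraMap F E)) (Matrix.map TW (algebraMap F E))))

include hTW2 in
/-- `adelicGram eD T_V (T_W ⊕ᶠ −T_W) = doubledGramFin (adelicGram e T_V T_W)`: the two `Sp(𝕎□_𝔸)` are the same subgroup of `Aut(𝕎□_𝔸)`.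
[cite: GelbartPiatetskishapiroRallis1987, Part A §2 pp. 7–9] -/
theorem adelicGram_doubled_eq_doubledGramFin :
    GelbartRogawski1991.UnitaryDualPair.adelicGram F
        (((Equiv.prodCongr (Equiv.refl (Fin N)) finSumFinEquiv.symm).trans (Equiv.prodSumDistrib (Fin N) (Fin 1) (Fin 1))).trans
          ((Equiv.sumCongr e e).trans finSumFinEquiv)) TV TW2 =
      doubledGramFin F (GelbartRogawski1991.UnitaryDualPair.adelicGram F e TV TW) := by
  subst hTW2
  rw [GelbartRogawski1991.UnitaryDualPair.adelicGram_eq_map, GelbartRogawski1991.UnitaryDualPair.adelicGram_eq_map, doubledGramFin_eq]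
  unfold finSum
  ext i j
  obtain ⟨x, rfl⟩ := finSumFinEquiv.surjective i
  obtain ⟨y, rfl⟩ := finSumFinEquiv.surjective j
  rcases x with i' | i' <;> rcases y with j' | j' <;>
    obtain ⟨⟨a, b⟩, rfl⟩ := e.surjective i' <;> obtain ⟨⟨a', b'⟩, rfl⟩ := e.surjective j' <;>
    simp [GelbartRogawski1991.UnitaryDualPair.gram, Matrix.kroneckerMap_apply, -finSumFinEquiv_apply_right, -finSumFinEquiv_apply_left]

omit [NumberField F] in
include hTW2 hWd in
/-- `det (T_W ⊕ᶠ −T_W)` is a unit. [cite: GelbartPiatetskishapiroRallis1987, Part A §2 pp. 7–9] -/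
theorem isUnit_det_doubledLine : IsUnit TW2.det := by
  subst hTW2
  unfold finSum
  rw [Matrix.reindex_apply, Matrix.det_submatrix_equiv_self, Matrix.det_fromBlocks_zero₂₁, Matrix.det_neg, Fintype.card_fin]
  exact (hWd.mul ((isUnit_one.neg.pow 1).mul hWd))

include hTW2 in
/-- **EXACT COMMUTATION OVER `P_Δ(F)`**: for `h ∈ U(J_V)(𝔸)` and `γ ∈ IW(F)` over a ROW-SUM `w ∈ U(F)`, `S̃(ι(h ⊗ 1)) · r_F(γ) = r_F(γ) · S̃(ι(h ⊗ 1))`: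
`ratSp γ^{±1}` stabilise `𝕎^Δ` (★ `isDiag_toSp_doubled_rationalInr`), so `ratSp (δγδ⁻¹) ∈ P_𝕐(𝔸)` (★ `conj_doublingDelta_mem_siegelParabolicPi_of_isDiag`)
and ★ `doublingLift_mul_ratThetaLiftCont_of_mem_siegel` applies with ★ `proj_doublingLift_toSp_adelicInl_mul_ratSp`.
[cite: Weil1964, Chap. I n° 13 p. 160 and Chap. III n° 41 Thm 6 p. 193] [cite: GelbartPiatetskishapiroRallis1987, Part A §2 pp. 7–9] -/
theorem doublingLift_toSp_adelicInl_mul_ratThetaLiftCont_of_rowSum (h : adelic F E c N (TV.map (algebraMap F E)))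
    (γ : Matrix.symplecticGroup (Fin (n + n)) F) (w : rational F E c (1 + 1) (TW2.map (algebraMap F E)))
    (hw : ((w : GL (Fin (1 + 1)) E) : Matrix (Fin (1 + 1)) (Fin (1 + 1)) E) 0 0 + ((w : GL (Fin (1 + 1)) E) : Matrix (Fin (1 + 1)) (Fin (1 + 1)) E) 0 1 =
      ((w : GL (Fin (1 + 1)) E) : Matrix (Fin (1 + 1)) (Fin (1 + 1)) E) 1 0 + ((w : GL (Fin (1 + 1)) E) : Matrix (Fin (1 + 1)) (Fin (1 + 1)) E) 1 1)
    (hγw : ((GelbartRogawski1991.UnitaryDualPair.toSp F E c N (1 + 1)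
          (((Equiv.prodCongr (Equiv.refl (Fin N)) finSumFinEquiv.symm).trans (Equiv.prodSumDistrib (Fin N) (Fin 1) (Fin 1))).trans
            ((Equiv.sumCongr e e).trans finSumFinEquiv))
          (TV.map (algebraMap F E)) (TW2.map (algebraMap F E)) hcδ hδ hd hV hW2 rfl rfl
          (adelicInr F E c N (1 + 1) (TV.map (algebraMap F E)) (TW2.map (algebraMap F E)) (toAdelic F E c (1 + 1) (TW2.map (algebraMap F E)) w)) :
          symplecticGroup (polar (Weil1964.adelicForm F (Fin (n + n))
            (GelbartRogawski1991.UnitaryDualPair.adelicGram F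
              (((Equiv.prodCongr (Equiv.refl (Fin N)) finSumFinEquiv.symm).trans (Equiv.prodSumDistrib (Fin N) (Fin 1) (Fin 1))).trans
                ((Equiv.sumCongr e e).trans finSumFinEquiv)) TV TW2)))) :
        ((Fin (n + n) → AdeleRing (𝓞 F) F) × (Fin (n + n) → AdeleRing (𝓞 F) F)) ≃ₗ[AdeleRing (𝓞 F) F]
          ((Fin (n + n) → AdeleRing (𝓞 F) F) × (Fin (n + n) → AdeleRing (𝓞 F) F))) =
      ((ratSp F (doubledGramFin F (GelbartRogawski1991.UnitaryDualPair.adelicGram F e TV TW))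
          (isUnit_det_doubledGramFin F _ (GelbartRogawski1991.UnitaryDualPair.isUnit_det_adelicGram F e hVd hWd)) γ :
          symplecticGroup (polar (Weil1964.adelicForm F (Fin (n + n))
            (doubledGramFin F (GelbartRogawski1991.UnitaryDualPair.adelicGram F e TV TW))))) :
        ((Fin (n + n) → AdeleRing (𝓞 F) F) × (Fin (n + n) → AdeleRing (𝓞 F) F)) ≃ₗ[AdeleRing (𝓞 F) F]
          ((Fin (n + n) → AdeleRing (𝓞 F) F) × (Fin (n + n) → AdeleRing (𝓞 F) F)))) :
    doublingLift F (GelbartRogawski1991.UnitaryDualPair.adelicGram F e TV TW)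
          (GelbartRogawski1991.UnitaryDualPair.isUnit_det_adelicGram F e hVd hWd)
          (GelbartRogawski1991.UnitaryDualPair.toSp F E c N 1 e (TV.map (algebraMap F E)) (TW.map (algebraMap F E)) hcδ hδ hd hV hW rfl rfl
            (adelicInl F E c N 1 (TV.map (algebraMap F E)) (TW.map (algebraMap F E)) h)) *
      ratThetaLiftCont F (doubledGramFin F (GelbartRogawski1991.UnitaryDualPair.adelicGram F e TV TW))
        (isUnit_det_doubledGramFin F _ (GelbartRogawski1991.UnitaryDualPair.isUnit_det_adelicGram F e hVd hWd)) γ =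
    ratThetaLiftCont F (doubledGramFin F (GelbartRogawski1991.UnitaryDualPair.adelicGram F e TV TW))
        (isUnit_det_doubledGramFin F _ (GelbartRogawski1991.UnitaryDualPair.isUnit_det_adelicGram F e hVd hWd)) γ *
      doublingLift F (GelbartRogawski1991.UnitaryDualPair.adelicGram F e TV TW)
          (GelbartRogawski1991.UnitaryDualPair.isUnit_det_adelicGram F e hVd hWd)
          (GelbartRogawski1991.UnitaryDualPair.toSp F E c N 1 e (TV.map (algebraMap F E)) (TW.map (algebraMap F E)) hcδ hδ hd hV hW rfl rfl
            (adelicInl F E c N 1 (TV.map (algebraMap F E)) (TW.map (algebraMap F E)) h)) := by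
  have hX : ∀ u : (Fin n ⊕ Fin n → AdeleRing (𝓞 F) F) × (Fin n ⊕ Fin n → AdeleRing (𝓞 F) F), Weil1964.IsDiag u →
      Weil1964.IsDiag ((reindexW (AdeleRing (𝓞 F) F) finSumFinEquiv).symm
        (((ratSp F 𝕋□ h𝕋□ γ : Sp□) : LE□) (reindexW (AdeleRing (𝓞 F) F) finSumFinEquiv u))) := fun u hu => by
    rw [← hγw]
    exact isDiag_toSp_doubled_rationalInr F E c hcδ hδ hd N e hV hW2 w hw u hu
  have hsymm : (((ratSp F 𝕋□ h𝕋□ γ : Sp□) : LE□)).symm =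
      (((ιW□) w⁻¹ : symplecticGroup (polar (Weil1964.adelicForm F (Fin (n + n))
        (GelbartRogawski1991.UnitaryDualPair.adelicGram F eD□ TV TW2)))) : LE□) :=
    (congrArg LinearEquiv.symm hγw.symm).trans
      (congrArg (fun z : symplecticGroup (polar (Weil1964.adelicForm F (Fin (n + n))
        (GelbartRogawski1991.UnitaryDualPair.adelicGram F eD□ TV TW2))) => (z : LE□)) ((ιW□).map_inv w)).symm
  have hX' : ∀ u : (Fin n ⊕ Fin n → AdeleRing (𝓞 F) F) × (Fin n ⊕ Fin n → AdeleRing (𝓞 F) F), Weil1964.IsDiag u →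
      Weil1964.IsDiag ((reindexW (AdeleRing (𝓞 F) F) finSumFinEquiv).symm
        ((((ratSp F 𝕋□ h𝕋□ γ : Sp□) : LE□)).symm (reindexW (AdeleRing (𝓞 F) F) finSumFinEquiv u))) := fun u hu => by
    rw [hsymm]
    exact isDiag_toSp_doubled_rationalInr F E c hcδ hδ hd N e hV hW2 w⁻¹ (rowSum_eq_inv _ hw) u hu
  have hmem := conj_doublingDelta_mem_siegelParabolicPi_of_isDiag F (GelbartRogawski1991.UnitaryDualPair.adelicGram F e TV TW)
    (GelbartRogawski1991.UnitaryDualPair.isUnit_det_adelicGram F e hVd hWd) (ratSp F 𝕋□ h𝕋□ γ) hX hX'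
  have hD : ratSp F 𝕋□ h𝕋□ (doublingDeltaRat F) =
      spReindex finSumFinEquiv (Matrix.fromBlocks (GelbartRogawski1991.UnitaryDualPair.adelicGram F e TV TW) 0 0
        (-GelbartRogawski1991.UnitaryDualPair.adelicGram F e TV TW))
        (doublingDelta (GelbartRogawski1991.UnitaryDualPair.adelicGram F e TV TW) (GelbartRogawski1991.UnitaryDualPair.isUnit_det_adelicGram F e hVd hWd)) :=
    ratSp_doublingDeltaRat F _ _
  have heq : ratSp F 𝕋□ h𝕋□ (doublingDeltaRat F * γ * (doublingDeltaRat F)⁻¹) =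
      spReindex finSumFinEquiv (Matrix.fromBlocks (GelbartRogawski1991.UnitaryDualPair.adelicGram F e TV TW) 0 0
          (-GelbartRogawski1991.UnitaryDualPair.adelicGram F e TV TW))
          (doublingDelta (GelbartRogawski1991.UnitaryDualPair.adelicGram F e TV TW) (GelbartRogawski1991.UnitaryDualPair.isUnit_det_adelicGram F e hVd hWd)) *
        ratSp F 𝕋□ h𝕋□ γ *
        (spReindex finSumFinEquiv (Matrix.fromBlocks (GelbartRogawski1991.UnitaryDualPair.adelicGram F e TV TW) 0 0
          (-GelbartRogawski1991.UnitaryDualPair.adelicGram F e TV TW))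
          (doublingDelta (GelbartRogawski1991.UnitaryDualPair.adelicGram F e TV TW) (GelbartRogawski1991.UnitaryDualPair.isUnit_det_adelicGram F e hVd hWd)))⁻¹ :=
    ((ratSp F 𝕋□ h𝕋□).map_mul _ _).trans
      (congrArg₂ (· * ·) (((ratSp F 𝕋□ h𝕋□).map_mul _ _).trans (congrArg (· * ratSp F 𝕋□ h𝕋□ γ) hD))
        (((ratSp F 𝕋□ h𝕋□).map_inv _).trans (congrArg (·⁻¹) hD)))
  have hP : ratSp F 𝕋□ h𝕋□ (doublingDeltaRat F * γ * (doublingDeltaRat F)⁻¹) ∈ siegelParabolicPi 𝕋□ := heq ▸ hmem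
  exact doublingLift_mul_ratThetaLiftCont_of_mem_siegel F (GelbartRogawski1991.UnitaryDualPair.adelicGram F e TV TW)
    (GelbartRogawski1991.UnitaryDualPair.isUnit_det_adelicGram F e hVd hWd)
    (GelbartRogawski1991.UnitaryDualPair.toSp F E c N 1 e (TV.map (algebraMap F E)) (TW.map (algebraMap F E)) hcδ hδ hd hV hW rfl rfl
      (adelicInl F E c N 1 (TV.map (algebraMap F E)) (TW.map (algebraMap F E)) h)) γ
    (proj_doublingLift_toSp_adelicInl_mul_ratSp F E c hcδ hδ hd N e hV hW hW2 hVd hWd hTW2 h γ w hγw) hP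

include hTW2 in
/-- **THE `V`-DIAGONAL DOUBLING LIFT COMMUTES ON THE NOSE WITH `r_F` ON `IW(F)`**: for `h ∈ U(J_V)(𝔸)` and `γ ∈ IW(F)` (`ratSp γ = ι_{eD}(1 ⊗ w)`,
`w ∈ U(J_W ⊕ᶠ −J_W)(F)`): `S̃(ι(h ⊗ 1)) · r_F(γ) = r_F(γ) · S̃(ι(h ⊗ 1))` in `Mp_ψ(𝕎□_𝔸)ᶜᵒⁿᵗ`.  Proof: `w ↦ S̃ r_F(γ_w) S̃⁻¹` is the twist of
`w ↦ r_F(γ_w)` by a character `χ : U(F) →* ℂˣ` (★ `adelicMpCont.exists_eq_twist`, same image in `Sp□(𝔸)`); `χ = 1` on `P_Δ(F)`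
(`…_of_rowSum`) hence everywhere (★ `monoidHom_apply_eq_one_of_forall_rowSum`).
[cite: MoeglinVignerasWaldspurger1987, Chap. 2 II.1] [cite: Kudla1994, §3] [cite: Weil1964, Chap. III n° 41 Thm 6 p. 193] -/
theorem doublingLift_toSp_adelicInl_mul_ratThetaLiftCont (h : adelic F E c N (TV.map (algebraMap F E)))
    (γ : Matrix.symplecticGroup (Fin (n + n)) F) (w : rational F E c (1 + 1) (TW2.map (algebraMap F E)))
    (hγw : ((GelbartRogawski1991.UnitaryDualPair.toSp F E c N (1 + 1)
          (((Equiv.prodCongr (Equiv.refl (Fin N)) finSumFinEquiv.symm).trans (Equiv.prodSumDistrib (Fin N) (Fin 1) (Fin 1))).trans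
            ((Equiv.sumCongr e e).trans finSumFinEquiv))
          (TV.map (algebraMap F E)) (TW2.map (algebraMap F E)) hcδ hδ hd hV hW2 rfl rfl
          (adelicInr F E c N (1 + 1) (TV.map (algebraMap F E)) (TW2.map (algebraMap F E)) (toAdelic F E c (1 + 1) (TW2.map (algebraMap F E)) w)) :
          symplecticGroup (polar (Weil1964.adelicForm F (Fin (n + n))
            (GelbartRogawski1991.UnitaryDualPair.adelicGram F
              (((Equiv.prodCongr (Equiv.refl (Fin N)) finSumFinEquiv.symm).trans (Equiv.prodSumDistrib (Fin N) (Fin 1) (Fin 1))).trans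
                ((Equiv.sumCongr e e).trans finSumFinEquiv)) TV TW2)))) :
        ((Fin (n + n) → AdeleRing (𝓞 F) F) × (Fin (n + n) → AdeleRing (𝓞 F) F)) ≃ₗ[AdeleRing (𝓞 F) F]
          ((Fin (n + n) → AdeleRing (𝓞 F) F) × (Fin (n + n) → AdeleRing (𝓞 F) F))) =
      ((ratSp F (doubledGramFin F (GelbartRogawski1991.UnitaryDualPair.adelicGram F e TV TW))
          (isUnit_det_doubledGramFin F _ (GelbartRogawski1991.UnitaryDualPair.isUnit_det_adelicGram F e hVd hWd)) γ :
          symplecticGroup (polar (Weil1964.adelicForm F (Fin (n + n))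
            (doubledGramFin F (GelbartRogawski1991.UnitaryDualPair.adelicGram F e TV TW))))) :
        ((Fin (n + n) → AdeleRing (𝓞 F) F) × (Fin (n + n) → AdeleRing (𝓞 F) F)) ≃ₗ[AdeleRing (𝓞 F) F]
          ((Fin (n + n) → AdeleRing (𝓞 F) F) × (Fin (n + n) → AdeleRing (𝓞 F) F)))) :
    doublingLift F (GelbartRogawski1991.UnitaryDualPair.adelicGram F e TV TW)
          (GelbartRogawski1991.UnitaryDualPair.isUnit_det_adelicGram F e hVd hWd)
          (GelbartRogawski1991.UnitaryDualPair.toSp F E c N 1 e (TV.map (algebraMap F E)) (TW.map (algebraMap F E)) hcδ hδ hd hV hW rfl rfl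
            (adelicInl F E c N 1 (TV.map (algebraMap F E)) (TW.map (algebraMap F E)) h)) *
      ratThetaLiftCont F (doubledGramFin F (GelbartRogawski1991.UnitaryDualPair.adelicGram F e TV TW))
        (isUnit_det_doubledGramFin F _ (GelbartRogawski1991.UnitaryDualPair.isUnit_det_adelicGram F e hVd hWd)) γ =
    ratThetaLiftCont F (doubledGramFin F (GelbartRogawski1991.UnitaryDualPair.adelicGram F e TV TW))
        (isUnit_det_doubledGramFin F _ (GelbartRogawski1991.UnitaryDualPair.isUnit_det_adelicGram F e hVd hWd)) γ *
      doublingLift F (GelbartRogawski1991.UnitaryDualPair.adelicGram F e TV TW)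
          (GelbartRogawski1991.UnitaryDualPair.isUnit_det_adelicGram F e hVd hWd)
          (GelbartRogawski1991.UnitaryDualPair.toSp F E c N 1 e (TV.map (algebraMap F E)) (TW.map (algebraMap F E)) hcδ hδ hd hV hW rfl rfl
            (adelicInl F E c N 1 (TV.map (algebraMap F E)) (TW.map (algebraMap F E)) h)) := by
  have hTT := adelicGram_doubled_eq_doubledGramFin F N e (TV := TV) hTW2
  have hW2d : IsUnit TW2.det := isUnit_det_doubledLine F hWd hTW2
  have hφex := fun w' : rational F E c (1 + 1) (TW2.map (algebraMap F E)) =>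
    exists_ratSp_coe_eq_toSp F E c hcδ hδ hd N (1 + 1)
      (((Equiv.prodCongr (Equiv.refl (Fin N)) finSumFinEquiv.symm).trans (Equiv.prodSumDistrib (Fin N) (Fin 1) (Fin 1))).trans
        ((Equiv.sumCongr e e).trans finSumFinEquiv)) hV hW2 hVd hW2d
      (doubledGramFin F (GelbartRogawski1991.UnitaryDualPair.adelicGram F e TV TW))
      (isUnit_det_doubledGramFin F _ (GelbartRogawski1991.UnitaryDualPair.isUnit_det_adelicGram F e hVd hWd)) hTT w'
  choose φf hφf using hφex
  have hinj : ∀ x y : Matrix.symplecticGroup (Fin (n + n)) F,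
      ((ratSp F 𝕋□ h𝕋□ x : Sp□) : LE□) = ((ratSp F 𝕋□ h𝕋□ y : Sp□) : LE□) → x = y := fun x y hxy => by
    have h1 := SymplecticMatrix.transportSp_injective _ _ (Subtype.ext hxy)
    refine Subtype.ext (Matrix.map_injective (AdeleRing.algebraMap_injective (𝓞 F) F) ?_)
    exact congrArg (fun A : Matrix.symplecticGroup (Fin (n + n)) (AdeleRing (𝓞 F) F) =>
      (A : Matrix (Fin (n + n) ⊕ Fin (n + n)) (Fin (n + n) ⊕ Fin (n + n)) (AdeleRing (𝓞 F) F))) h1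
  -- `w ↦ γ_w` is multiplicative: a homomorphism `φ : U(J_W ⊕ᶠ −J_W)(F) →* Sp_{2(n+n)}(F)` with `ratSp ∘ φ = ι_{eD}(1 ⊗ ·)`
  have hφmul : ∀ a b, φf (a * b) = φf a * φf b := fun a b => hinj _ _ <|
    (hφf (a * b)).trans <| (congrArg (fun z : symplecticGroup (polar (Weil1964.adelicForm F (Fin (n + n))
        (GelbartRogawski1991.UnitaryDualPair.adelicGram F eD□ TV TW2))) => (z : LE□)) ((ιW□).map_mul a b)).trans <|
      (congrArg₂ (· * ·) (hφf a).symm (hφf b).symm).trans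
        (congrArg (fun z : Sp□ => (z : LE□)) ((ratSp F 𝕋□ h𝕋□).map_mul (φf a) (φf b)).symm)
  have hex1 : ∃ s₁ : rational F E c (1 + 1) (TW2.map (algebraMap F E)) →* adelicMpCont F (Fin (n + n)) 𝕋□,
      ∀ w', s₁ w' = ratThetaLiftCont F 𝕋□ h𝕋□ (φf w') :=
    ⟨(ratThetaLiftCont F 𝕋□ h𝕋□).comp (MonoidHom.mk' φf hφmul), fun _ => by simp only [MonoidHom.comp_apply, MonoidHom.mk'_apply]⟩
  obtain ⟨s₁, hs₁⟩ := hex1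
  have hex2 : ∃ s₂ : rational F E c (1 + 1) (TW2.map (algebraMap F E)) →* adelicMpCont F (Fin (n + n)) 𝕋□,
      ∀ w', s₂ w' = x□ h * s₁ w' * (x□ h)⁻¹ :=
    ⟨(MulAut.conj (x□ h)).toMonoidHom.comp s₁, fun _ => by simp only [MonoidHom.comp_apply, MulEquiv.coe_toMonoidHom, MulAut.conj_apply]⟩
  obtain ⟨s₂, hs₂⟩ := hex2
  have hproj : ∀ w', adelicMpCont.proj F (Fin (n + n)) 𝕋□ (s₁ w') = adelicMpCont.proj F (Fin (n + n)) 𝕋□ (s₂ w') := fun w' => by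
    have hc := proj_doublingLift_toSp_adelicInl_mul_ratSp F E c hcδ hδ hd N e hV hW hW2 hVd hWd hTW2 h (φf w') w' (hφf w').symm
    have a3 : adelicMpCont.proj F (Fin (n + n)) 𝕋□ (s₁ w') = ratSp F 𝕋□ h𝕋□ (φf w') :=
      (congrArg (adelicMpCont.proj F (Fin (n + n)) 𝕋□) (hs₁ w')).trans (proj_ratThetaLiftCont F 𝕋□ h𝕋□ (φf w'))
    refine Eq.symm ((congrArg (adelicMpCont.proj F (Fin (n + n)) 𝕋□) (hs₂ w')).trans ?_)
    calc adelicMpCont.proj F (Fin (n + n)) 𝕋□ (x□ h * s₁ w' * (x□ h)⁻¹)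
        = adelicMpCont.proj F (Fin (n + n)) 𝕋□ (x□ h) * adelicMpCont.proj F (Fin (n + n)) 𝕋□ (s₁ w') *
            (adelicMpCont.proj F (Fin (n + n)) 𝕋□ (x□ h))⁻¹ :=
          ((adelicMpCont.proj F (Fin (n + n)) 𝕋□).map_mul _ _).trans
            (congrArg₂ (· * ·) ((adelicMpCont.proj F (Fin (n + n)) 𝕋□).map_mul _ _) ((adelicMpCont.proj F (Fin (n + n)) 𝕋□).map_inv _))
      _ = adelicMpCont.proj F (Fin (n + n)) 𝕋□ (x□ h) * ratSp F 𝕋□ h𝕋□ (φf w') * (adelicMpCont.proj F (Fin (n + n)) 𝕋□ (x□ h))⁻¹ :=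
          congrArg (fun z => adelicMpCont.proj F (Fin (n + n)) 𝕋□ (x□ h) * z * (adelicMpCont.proj F (Fin (n + n)) 𝕋□ (x□ h))⁻¹) a3
      _ = ratSp F 𝕋□ h𝕋□ (φf w') * adelicMpCont.proj F (Fin (n + n)) 𝕋□ (x□ h) * (adelicMpCont.proj F (Fin (n + n)) 𝕋□ (x□ h))⁻¹ :=
          congrArg (· * (adelicMpCont.proj F (Fin (n + n)) 𝕋□ (x□ h))⁻¹) hc
      _ = ratSp F 𝕋□ h𝕋□ (φf w') := mul_inv_cancel_right _ _
      _ = adelicMpCont.proj F (Fin (n + n)) 𝕋□ (s₁ w') := a3.symm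
  have hTu : IsUnit (𝕋□) := (Matrix.isUnit_iff_isUnit_det _).2 h𝕋□
  have hexχ := adelicMpCont.exists_eq_twist s₁ s₂ hTu hproj
  obtain ⟨χ, hχ⟩ := hexχ
  have hχw : ∀ w', x□ h * ratThetaLiftCont F 𝕋□ h𝕋□ (φf w') * (x□ h)⁻¹ =
      adelicMpCont.ofScalar F (Fin (n + n)) 𝕋□ (χ w') * ratThetaLiftCont F 𝕋□ h𝕋□ (φf w') := fun w' => by
    calc x□ h * ratThetaLiftCont F 𝕋□ h𝕋□ (φf w') * (x□ h)⁻¹ = x□ h * s₁ w' * (x□ h)⁻¹ :=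
          congrArg (fun z => x□ h * z * (x□ h)⁻¹) (hs₁ w').symm
      _ = s₂ w' := (hs₂ w').symm
      _ = adelicMpCont.twist F (Fin (n + n)) 𝕋□ s₁ χ w' := DFunLike.congr_fun hχ w'
      _ = adelicMpCont.ofScalar F (Fin (n + n)) 𝕋□ (χ w') * s₁ w' := adelicMpCont.twist_apply (F := F) (ι := Fin (n + n)) (T := 𝕋□) s₁ χ w'
      _ = adelicMpCont.ofScalar F (Fin (n + n)) 𝕋□ (χ w') * ratThetaLiftCont F 𝕋□ h𝕋□ (φf w') :=
          congrArg (adelicMpCont.ofScalar F (Fin (n + n)) 𝕋□ (χ w') * ·) (hs₁ w')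
  -- (e) `χ = 1` on the rational Siegel points `P_Δ(F)` (row-sum `w'`): there the commutation is EXACT
  have hχP : ∀ w' : rational F E c (1 + 1) (TW2.map (algebraMap F E)),
      ((w' : GL (Fin (1 + 1)) E) : Matrix (Fin (1 + 1)) (Fin (1 + 1)) E) 0 0 + ((w' : GL (Fin (1 + 1)) E) : Matrix (Fin (1 + 1)) (Fin (1 + 1)) E) 0 1 =
        ((w' : GL (Fin (1 + 1)) E) : Matrix (Fin (1 + 1)) (Fin (1 + 1)) E) 1 0 + ((w' : GL (Fin (1 + 1)) E) : Matrix (Fin (1 + 1)) (Fin (1 + 1)) E) 1 1 →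
      χ w' = 1 := fun w' hw' => by
    have hcommP := doublingLift_toSp_adelicInl_mul_ratThetaLiftCont_of_rowSum F E c hcδ hδ hd N e hV hW hW2 hVd hWd hTW2 h (φf w') w' hw'
      (hφf w').symm
    have h2 : x□ h * ratThetaLiftCont F 𝕋□ h𝕋□ (φf w') * (x□ h)⁻¹ = ratThetaLiftCont F 𝕋□ h𝕋□ (φf w') :=
      (congrArg (· * (x□ h)⁻¹) hcommP).trans (mul_inv_cancel_right _ _)
    have h3 : adelicMpCont.ofScalar F (Fin (n + n)) 𝕋□ (χ w') * ratThetaLiftCont F 𝕋□ h𝕋□ (φf w') =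
        1 * ratThetaLiftCont F 𝕋□ h𝕋□ (φf w') := ((hχw w').symm.trans h2).trans (one_mul _).symm
    exact adelicMpCont.ofScalar_injective ((mul_right_cancel h3).trans (map_one _).symm)
  -- (f) conclusion: `χ = 1` everywhere (§1), so the twist is trivial; and `γ = γ_w`
  have hχ1 := monoidHom_apply_eq_one_of_forall_rowSum F E c hcδ hδ hW hWd hTW2 χ hχP
  have h2 : adelicMpCont.ofScalar F (Fin (n + n)) 𝕋□ (χ w) = 1 :=
    (congrArg (adelicMpCont.ofScalar F (Fin (n + n)) 𝕋□) (hχ1 w)).trans (map_one _)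
  have hx : x□ h * ratThetaLiftCont F 𝕋□ h𝕋□ (φf w) * (x□ h)⁻¹ = ratThetaLiftCont F 𝕋□ h𝕋□ (φf w) :=
    (hχw w).trans ((congrArg (· * ratThetaLiftCont F 𝕋□ h𝕋□ (φf w)) h2).trans (one_mul _))
  have hγφ : γ = φf w := hinj _ _ (hγw.symm.trans (hφf w).symm)
  subst hγφ
  exact mul_inv_eq_iff_eq_mul.1 hx

/-! ## §3 Consequently `Θ ∘ ω□(S̃(ι(g ⊗ 1)))` and the doubled theta integral are invariant under `ω□(r_F γ)`, `γ ∈ IW(F)` -/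

omit [NumberField E] [Algebra.IsQuadraticExtension F E] in
/-- `ω□(p q) Ψ = ω□(p) (ω□(q) Ψ)`: the Weil representation of `Mp_ψ(𝕎_𝔸)ᶜᵒⁿᵗ` is a homomorphism. [cite: Weil1964, Chap. I n° 13 p. 160] -/
theorem omega_mul_apply₂ {m : ℕ} (T' : Matrix (Fin m) (Fin m) (AdeleRing (𝓞 F) F)) (p q : adelicMpCont F (Fin m) T')
    (Φ : piSchwartzBruhat F (Fin m)) :
    adelicMpCont.omega F (Fin m) T' (p * q) Φ = adelicMpCont.omega F (Fin m) T' p (adelicMpCont.omega F (Fin m) T' q Φ) :=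
  LinearMap.congr_fun (map_mul (adelicMpCont.omega F (Fin m) T') p q) Φ

include hTW2 in
/-- **Θ-INVARIANCE**: for `g ∈ U(J_V)(𝔸)`, `γ ∈ IW(F)` and `Ψ ∈ 𝒮(𝔸_F^{n+n})`, `Θ(ω□(S̃(ι(g ⊗ 1)))(ω□(r_F γ)Ψ)) = Θ(ω□(S̃(ι(g ⊗ 1)))Ψ)` (§2 +
Θ-rigidity ★ `thetaDist_omega_ratThetaLiftCont`; the lift is written as the composite hom `S̃ ∘ ι_e ∘ (· ⊗ 1)` = the E-2 child's `vDiagLift`).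
[cite: Weil1964, Chap. III n° 41 Thm 6 p. 193] [cite: Li1992, (24) p. 184] -/
theorem thetaDistLM_omega_doublingLift_omega_ratThetaLiftCont (g : adelic F E c N (TV.map (algebraMap F E)))
    (γ : Matrix.symplecticGroup (Fin (n + n)) F) (w : rational F E c (1 + 1) (TW2.map (algebraMap F E)))
    (hγw : ((GelbartRogawski1991.UnitaryDualPair.toSp F E c N (1 + 1)
          (((Equiv.prodCongr (Equiv.refl (Fin N)) finSumFinEquiv.symm).trans (Equiv.prodSumDistrib (Fin N) (Fin 1) (Fin 1))).trans
            ((Equiv.sumCongr e e).trans finSumFinEquiv))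
          (TV.map (algebraMap F E)) (TW2.map (algebraMap F E)) hcδ hδ hd hV hW2 rfl rfl
          (adelicInr F E c N (1 + 1) (TV.map (algebraMap F E)) (TW2.map (algebraMap F E)) (toAdelic F E c (1 + 1) (TW2.map (algebraMap F E)) w)) :
          symplecticGroup (polar (Weil1964.adelicForm F (Fin (n + n))
            (GelbartRogawski1991.UnitaryDualPair.adelicGram F
              (((Equiv.prodCongr (Equiv.refl (Fin N)) finSumFinEquiv.symm).trans (Equiv.prodSumDistrib (Fin N) (Fin 1) (Fin 1))).trans
                ((Equiv.sumCongr e e).trans finSumFinEquiv)) TV TW2)))) :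
        ((Fin (n + n) → AdeleRing (𝓞 F) F) × (Fin (n + n) → AdeleRing (𝓞 F) F)) ≃ₗ[AdeleRing (𝓞 F) F]
          ((Fin (n + n) → AdeleRing (𝓞 F) F) × (Fin (n + n) → AdeleRing (𝓞 F) F))) =
      ((ratSp F (doubledGramFin F (GelbartRogawski1991.UnitaryDualPair.adelicGram F e TV TW))
          (isUnit_det_doubledGramFin F _ (GelbartRogawski1991.UnitaryDualPair.isUnit_det_adelicGram F e hVd hWd)) γ :
          symplecticGroup (polar (Weil1964.adelicForm F (Fin (n + n))
            (doubledGramFin F (GelbartRogawski1991.UnitaryDualPair.adelicGram F e TV TW))))) :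
        ((Fin (n + n) → AdeleRing (𝓞 F) F) × (Fin (n + n) → AdeleRing (𝓞 F) F)) ≃ₗ[AdeleRing (𝓞 F) F]
          ((Fin (n + n) → AdeleRing (𝓞 F) F) × (Fin (n + n) → AdeleRing (𝓞 F) F))))
    (Ψ : piSchwartzBruhat F (Fin (n + n))) :
    thetaDistLM F (Fin (n + n))
        (adelicMpCont.omega F (Fin (n + n)) (doubledGramFin F (GelbartRogawski1991.UnitaryDualPair.adelicGram F e TV TW)) ((x□) g)
          (adelicMpCont.omega F (Fin (n + n)) (doubledGramFin F (GelbartRogawski1991.UnitaryDualPair.adelicGram F e TV TW))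
            (ratThetaLiftCont F (doubledGramFin F (GelbartRogawski1991.UnitaryDualPair.adelicGram F e TV TW))
              (isUnit_det_doubledGramFin F _ (GelbartRogawski1991.UnitaryDualPair.isUnit_det_adelicGram F e hVd hWd)) γ) Ψ)) =
      thetaDistLM F (Fin (n + n))
        (adelicMpCont.omega F (Fin (n + n)) (doubledGramFin F (GelbartRogawski1991.UnitaryDualPair.adelicGram F e TV TW)) ((x□) g) Ψ) := by
  have hc : x□ g * ratThetaLiftCont F 𝕋□ h𝕋□ γ = ratThetaLiftCont F 𝕋□ h𝕋□ γ * x□ g :=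
    doublingLift_toSp_adelicInl_mul_ratThetaLiftCont F E c hcδ hδ hd N e hV hW hW2 hVd hWd hTW2 g γ w hγw
  have h1 : adelicMpCont.omega F (Fin (n + n)) 𝕋□ (x□ g) (adelicMpCont.omega F (Fin (n + n)) 𝕋□ (ratThetaLiftCont F 𝕋□ h𝕋□ γ) Ψ) =
      adelicMpCont.omega F (Fin (n + n)) 𝕋□ (ratThetaLiftCont F 𝕋□ h𝕋□ γ) (adelicMpCont.omega F (Fin (n + n)) 𝕋□ (x□ g) Ψ) :=
    (omega_mul_apply₂ F 𝕋□ (x□ g) (ratThetaLiftCont F 𝕋□ h𝕋□ γ) Ψ).symm.trans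
      ((congrArg (fun z => adelicMpCont.omega F (Fin (n + n)) 𝕋□ z Ψ) hc).trans
        (omega_mul_apply₂ F 𝕋□ (ratThetaLiftCont F 𝕋□ h𝕋□ γ) (x□ g) Ψ))
  exact (congrArg (thetaDistLM F (Fin (n + n))) h1).trans
    (thetaDist_omega_ratThetaLiftCont F 𝕋□ h𝕋□ γ (adelicMpCont.omega F (Fin (n + n)) 𝕋□ (x□ g) Ψ))

include hTW2 in
/-- **`I□(ω□(r_F γ)Ψ) = I□(Ψ)` for `γ ∈ IW(F)`**, `I□(Ψ) := ∫_{[U(J_V)]} Θ(ω□(S̃(ι(ξ̃⁻¹ ⊗ 1)))Ψ) dν(ξ)` (integrand at `ξ̃ = ξ.out`; the E-2 child's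
`doubledThetaIntegral`, any `ν`): pointwise equality of the integrands — no measurability or integrability used.
[cite: Weil1965, n° 52 Thm 5] [cite: Li1992, (24) p. 184] [cite: Weil1964, Chap. III n° 41 Thm 6 p. 193] -/
theorem integral_thetaDistLM_omega_doublingLift_omega_ratThetaLiftCont
    [MeasurableSpace (adelic F E c N (TV.map (algebraMap F E)) ⧸ (toAdelic F E c N (TV.map (algebraMap F E))).range)]
    (ν : MeasureTheory.Measure (adelic F E c N (TV.map (algebraMap F E)) ⧸ (toAdelic F E c N (TV.map (algebraMap F E))).range))
    (γ : Matrix.symplecticGroup (Fin (n + n)) F) (w : rational F E c (1 + 1) (TW2.map (algebraMap F E)))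
    (hγw : ((GelbartRogawski1991.UnitaryDualPair.toSp F E c N (1 + 1)
          (((Equiv.prodCongr (Equiv.refl (Fin N)) finSumFinEquiv.symm).trans (Equiv.prodSumDistrib (Fin N) (Fin 1) (Fin 1))).trans
            ((Equiv.sumCongr e e).trans finSumFinEquiv))
          (TV.map (algebraMap F E)) (TW2.map (algebraMap F E)) hcδ hδ hd hV hW2 rfl rfl
          (adelicInr F E c N (1 + 1) (TV.map (algebraMap F E)) (TW2.map (algebraMap F E)) (toAdelic F E c (1 + 1) (TW2.map (algebraMap F E)) w)) :
          symplecticGroup (polar (Weil1964.adelicForm F (Fin (n + n))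
            (GelbartRogawski1991.UnitaryDualPair.adelicGram F
              (((Equiv.prodCongr (Equiv.refl (Fin N)) finSumFinEquiv.symm).trans (Equiv.prodSumDistrib (Fin N) (Fin 1) (Fin 1))).trans
                ((Equiv.sumCongr e e).trans finSumFinEquiv)) TV TW2)))) :
        ((Fin (n + n) → AdeleRing (𝓞 F) F) × (Fin (n + n) → AdeleRing (𝓞 F) F)) ≃ₗ[AdeleRing (𝓞 F) F]
          ((Fin (n + n) → AdeleRing (𝓞 F) F) × (Fin (n + n) → AdeleRing (𝓞 F) F))) =
      ((ratSp F (doubledGramFin F (GelbartRogawski1991.UnitaryDualPair.adelicGram F e TV TW))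
          (isUnit_det_doubledGramFin F _ (GelbartRogawski1991.UnitaryDualPair.isUnit_det_adelicGram F e hVd hWd)) γ :
          symplecticGroup (polar (Weil1964.adelicForm F (Fin (n + n))
            (doubledGramFin F (GelbartRogawski1991.UnitaryDualPair.adelicGram F e TV TW))))) :
        ((Fin (n + n) → AdeleRing (𝓞 F) F) × (Fin (n + n) → AdeleRing (𝓞 F) F)) ≃ₗ[AdeleRing (𝓞 F) F]
          ((Fin (n + n) → AdeleRing (𝓞 F) F) × (Fin (n + n) → AdeleRing (𝓞 F) F))))
    (Ψ : piSchwartzBruhat F (Fin (n + n))) :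
    ∫ ξ, thetaDistLM F (Fin (n + n))
        (adelicMpCont.omega F (Fin (n + n)) (doubledGramFin F (GelbartRogawski1991.UnitaryDualPair.adelicGram F e TV TW)) ((x□) (Quotient.out ξ)⁻¹)
          (adelicMpCont.omega F (Fin (n + n)) (doubledGramFin F (GelbartRogawski1991.UnitaryDualPair.adelicGram F e TV TW))
            (ratThetaLiftCont F (doubledGramFin F (GelbartRogawski1991.UnitaryDualPair.adelicGram F e TV TW))
              (isUnit_det_doubledGramFin F _ (GelbartRogawski1991.UnitaryDualPair.isUnit_det_adelicGram F e hVd hWd)) γ) Ψ)) ∂ν =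
      ∫ ξ, thetaDistLM F (Fin (n + n))
        (adelicMpCont.omega F (Fin (n + n)) (doubledGramFin F (GelbartRogawski1991.UnitaryDualPair.adelicGram F e TV TW)) ((x□) (Quotient.out ξ)⁻¹) Ψ) ∂ν :=
  congrArg (fun f : (adelic F E c N (TV.map (algebraMap F E)) ⧸ (toAdelic F E c N (TV.map (algebraMap F E))).range) → ℂ => ∫ ξ, f ξ ∂ν)
    (funext fun ξ => thetaDistLM_omega_doublingLift_omega_ratThetaLiftCont F E c hcδ hδ hd N e hV hW hW2 hVd hWd hTW2 (Quotient.out ξ)⁻¹ γ w hγw Ψ)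

end DoubledPair

end UnitaryGroup

end Literature.NumberTheory.Automorphic
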